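import Summits.ResolutionOfSingularities.ResolutionOfSingularities.Theorems.WeightedInvariantWeightedThesisHypersurfaceModelFieldCore
import Literature.AlgebraicGeometry.Motives.CyclesDimensionFunctionField
import Mathlib.FieldTheory.SeparablyGenerated
import Mathlib.RingTheory.Kaehler.Basic

/-!
# `WeightedInvariant.WeightedThesis`, line `datum-glued-split`, stub 5a-F1:
# Kähler differentials of the function field of a variety over a perfect field

Support file for `stub_hypersurfaceModel_infinite` (crux `WeightedThesis`,
stmt-ResolutionOfSingularities-0569), all PROVED. For an integral scheme `X` locally of finite type
over a PERFECT field `k`, with `K(X)` a `k`-algebra through `k = Γ(Spec k) → Γ(X, ⊤) → K(X)`: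

* `FunctionFieldKaehler.essFiniteType_functionField` — `K(X) / k` is essentially of finite type
  (`K(X) = Frac Γ(X, U)` for an affine chart `U`, a finitely generated `k`-algebra);
* `FunctionFieldKaehler.finrank_kaehlerDifferential_eq_trdeg` — pure field theory: for `K / k`
  essentially of finite type over a perfect field, `Ω[K⁄k]` is finite-dimensional of dimension
  `trdeg_k K` (`K / k` is separably generated, Mathlib
  `exists_isTranscendenceBasis_and_isSeparable_of_perfectField`; then
  `FieldCore.finrank_le_of_isSeparable` and `FieldCore.trdeg_le_finrank`);
* `FunctionFieldKaehler.functionFieldKaehler` and the registered shape `stub_functionFieldKaehler` —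
  `K(X) / k` is essentially of finite type, `Ω[K(X)⁄k]` is finite-dimensional, and
  `dim_{K(X)} Ω[K(X)⁄k] = dim X ∈ ℕ` (`dim X = trdeg_k K(X)`,
  `Literature.AlgebraicGeometry.Motives.height_top_eq_trdeg`).

[Hartshorne II Thm. 8.6A; Matsumura, Commutative Ring Theory, Thm. 26.2–26.3; Görtz–Wedhorn I,
Thm. 5.22 (3)]
-/

noncomputable section

set_option linter.dupNamespace false -- mandated namespace of this single-conjunct summit

open CategoryTheory AlgebraicGeometry Order

namespace Summit.ResolutionOfSingularities.ResolutionOfSingularities.Theorems.WeightedThesis.HypersurfaceModel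

namespace FunctionFieldKaehler

universe u

/-! ## Field theory: `dim_K Ω[K⁄k] = trdeg_k K` over a perfect field -/

/-- **`dim_K Ω[K⁄k] = trdeg_k K` for `K / k` essentially of finite type over a perfect field**
(and `Ω[K⁄k]` is finite-dimensional): `K / k` admits a separating transcendence basis `s`
(Mathlib `exists_isTranscendenceBasis_and_isSeparable_of_perfectField`), so `Ω[K⁄k]` is spanned
by `ds` (`FieldCore.finrank_le_of_isSeparable`, `dim ≤ #s = trdeg`), and `trdeg ≤ dim Ω[K⁄k]`
always (`FieldCore.trdeg_le_finrank`). [folklore; Hartshorne II Thm. 8.6A] -/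
theorem finrank_kaehlerDifferential_eq_trdeg (k K : Type*) [Field k] [Field K] [Algebra k K]
    [PerfectField k] [Algebra.EssFiniteType k K] :
    Module.Finite K (Ω[K⁄k]) ∧
      (Module.finrank K (Ω[K⁄k]) : Cardinal) = Algebra.trdeg k K := by
  obtain ⟨s, hs, hsep⟩ := exists_isTranscendenceBasis_and_isSeparable_of_perfectField k K
  haveI := hsep
  obtain ⟨hfin, hle⟩ := FieldCore.finrank_le_of_isSeparable (k := k) s
  haveI := hfin
  have hge := FieldCore.trdeg_le_finrank (k := k) (K := K)
  have hcard : (s.card : Cardinal) = Algebra.trdeg k K := by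
    rw [← Cardinal.mk_coe_finset, hs.cardinalMk_eq_trdeg]
  refine ⟨hfin, le_antisymm ?_ hge⟩
  rw [← hcard]
  exact_mod_cast hle

/-! ## The function field of a variety -/

variable {k : Type u} [Field k] {X : Scheme.{u}} [IsIntegral X] (f : X ⟶ Spec (.of k))
  [LocallyOfFiniteType f]

/-- The topological Krull dimension of an integral scheme is the dimension (`Order.height` in the
specialisation order) of its generic point. [folklore] -/
theorem topologicalKrullDim_eq_height_genericPoint (Y : Scheme.{u}) [IsIntegral Y] :
    topologicalKrullDim Y = height (genericPoint Y) := by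
  -- adapted from Literature/AlgebraicGeometry/Motives/LinesGenerateChowOneSumSq.lean
  rw [show topologicalKrullDim Y = krullDim Y from
    Order.krullDim_eq_of_orderIso (irreducibleSetEquivPoints (α := Y))]
  exact (Order.height_top_eq_krullDim (α := Y)).symm

include f in
/-- **`K(X) / k` is essentially of finite type** for an integral scheme `X` locally of finite type
over a field `k`, `K(X)` being a `k`-algebra through `k = Γ(Spec k) → Γ(X, ⊤) → K(X)`: for an
affine chart `U ∋ η`, `Γ(X, U)` is a finitely generated `k`-algebra
(`Scheme.Hom.finiteType_appLE`) and `K(X) = Frac Γ(X, U)`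
(Mathlib `functionField_isFractionRing_of_isAffineOpen`) is a localization of it. [folklore] -/
theorem essFiniteType_functionField :
    letI := ((X.presheaf.germ ⊤ (genericPoint X) trivial).hom.comp
      (f.appTop.hom.comp (Scheme.ΓSpecIso (.of k)).inv.hom)).toAlgebra
    Algebra.EssFiniteType k X.functionField := by
  -- adapted from Literature/AlgebraicGeometry/Motives/CyclesDimensionFunctionField.lean
  letI algK := ((X.presheaf.germ ⊤ (genericPoint X) trivial).hom.comp
      (f.appTop.hom.comp (Scheme.ΓSpecIso (.of k)).inv.hom)).toAlgebra
  obtain ⟨_, ⟨U, hU, rfl⟩, hηU, -⟩ :=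
    X.isBasis_affineOpens.exists_subset_of_mem_open (Set.mem_univ (⊤ : X)) isOpen_univ
  have hU : IsAffineOpen U := hU
  haveI : Nonempty U := ⟨⟨⊤, hηU⟩⟩
  let ι : k →+* Γ(Spec (CommRingCat.of k), ⊤) := (Scheme.ΓSpecIso (CommRingCat.of k)).inv.hom
  let φU : k →+* Γ(X, U) := (f.appLE ⊤ U le_top).hom.comp ι
  letI algU : Algebra k Γ(X, U) := φU.toAlgebra
  haveI : Algebra.FiniteType k Γ(X, U) := by
    have h1 : (f.appLE ⊤ U le_top).hom.FiniteType :=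
      f.finiteType_appLE (isAffineOpen_top _) hU le_top
    have h2 : ι.FiniteType :=
      RingHom.FiniteType.of_surjective _
        (Scheme.ΓSpecIso (CommRingCat.of k)).symm.commRingCatIsoToRingEquiv.surjective
    exact h1.comp h2
  haveI : IsFractionRing Γ(X, U) X.functionField :=
    functionField_isFractionRing_of_isAffineOpen X U hU
  haveI : IsScalarTower k Γ(X, U) X.functionField := by
    refine IsScalarTower.of_algebraMap_eq fun c ↦ ?_
    change (X.presheaf.germ ⊤ (genericPoint X) trivial) (f.appTop (ι c)) =
      X.germToFunctionField U ((f.app ⊤ ≫ X.presheaf.map (homOfLE le_top).op) (ι c))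
    have hres := TopCat.Presheaf.germ_res X.presheaf (homOfLE (le_top : U ≤ ⊤)) (genericPoint X)
      hηU
    rw [Scheme.germToFunctionField, ← hres]
    rfl
  haveI : Algebra.EssFiniteType Γ(X, U) X.functionField :=
    Algebra.EssFiniteType.of_isLocalization _ (nonZeroDivisors Γ(X, U))
  exact Algebra.EssFiniteType.comp k Γ(X, U) X.functionField

include f in
/-- **Kähler differentials of the function field of a variety over a perfect field.** For an
integral scheme `X` locally of finite type over a perfect field `k` and ANY `k`-algebra structure
on `K(X)` whose structure map is `k = Γ(Spec k) → Γ(X, ⊤) → K(X)`: `K(X) / k` is essentially of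
finite type, `Ω[K(X)⁄k]` is finite-dimensional, and `dim_{K(X)} Ω[K(X)⁄k] = dim X` (a natural
number) — `dim X = trdeg_k K(X)` (`Literature.AlgebraicGeometry.Motives.height_top_eq_trdeg`,
Görtz–Wedhorn I Thm. 5.22 (3)) `= dim Ω[K(X)⁄k]` (`finrank_kaehlerDifferential_eq_trdeg`).
[folklore; Hartshorne II Thm. 8.6A] -/
theorem functionFieldKaehler [PerfectField k] [alg : Algebra k X.functionField]
    (halg : algebraMap k X.functionField = (X.presheaf.germ ⊤ (genericPoint X) trivial).hom.comp
      (f.appTop.hom.comp (Scheme.ΓSpecIso (.of k)).inv.hom)) :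
    Algebra.EssFiniteType k X.functionField ∧
      Module.Finite X.functionField (Ω[X.functionField⁄k]) ∧
      ∃ d : ℕ, topologicalKrullDim X = d ∧
        Module.finrank X.functionField (Ω[X.functionField⁄k]) = d := by
  -- an `Algebra` structure is determined by its structure map
  have hinst : alg = ((X.presheaf.germ ⊤ (genericPoint X) trivial).hom.comp
      (f.appTop.hom.comp (Scheme.ΓSpecIso (.of k)).inv.hom)).toAlgebra :=
    Algebra.algebra_ext _ _ fun r => by rw [halg]; rfl
  subst hinst
  letI algK : Algebra k X.functionField := ((X.presheaf.germ ⊤ (genericPoint X) trivial).hom.comp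
    (f.appTop.hom.comp (Scheme.ΓSpecIso (.of k)).inv.hom)).toAlgebra
  haveI : Algebra.EssFiniteType k X.functionField := essFiniteType_functionField f
  obtain ⟨hfin, hrank⟩ := finrank_kaehlerDifferential_eq_trdeg k X.functionField
  refine ⟨inferInstance, hfin, Cardinal.toNat (Algebra.trdeg k X.functionField), ?_, ?_⟩
  · rw [topologicalKrullDim_eq_height_genericPoint]
    exact Literature.AlgebraicGeometry.Motives.height_top_eq_trdeg f
  · exact (Cardinal.toNat_natCast _).symm.trans (congrArg Cardinal.toNat hrank)

end FunctionFieldKaehler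

/-- **Registered shape (universe `0`) of stub 5a-F1** (`stub_functionFieldKaehler` of the line
`datum-glued-split`): for an integral scheme `X` of finite type over a PERFECT field `k`, with
`K(X)` given the `k`-algebra structure `k → Γ(Spec k) → Γ(X, ⊤) → K(X)`, `K(X) / k` is essentially
of finite type, `Ω[K(X)⁄k]` is finite-dimensional, and `dim_{K(X)} Ω[K(X)⁄k] = dim X ∈ ℕ`
(`FunctionFieldKaehler.functionFieldKaehler`; quasi-compactness is not needed).
[folklore; Hartshorne II Thm. 8.6A; Görtz–Wedhorn I Thm. 5.22 (3)] -/
theorem stub_functionFieldKaehler : ∀ (k : Type) [Field k] [PerfectField k] (X : AlgebraicGeometry.Scheme.{0}) [AlgebraicGeometry.IsIntegral X] (f : X ⟶ AlgebraicGeometry.Spec (.of k)) [AlgebraicGeometry.LocallyOfFiniteType f] [AlgebraicGeometry.QuasiCompact f] [Algebra k X.functionField], algebraMap k X.functionField = (X.presheaf.germ ⊤ (genericPoint X) trivial).hom.comp (f.appTop.hom.comp (AlgebraicGeometry.Scheme.ΓSpecIso (.of k)).inv.hom) → Algebra.EssFiniteType k X.functionField ∧ Module.Finite X.functionField (Ω[X.functionField⁄k])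 ∧ ∃ d : ℕ, topologicalKrullDim X = d ∧ Module.finrank X.functionField (Ω[X.functionField⁄k]) = d :=
  fun _ _ _ _ _ f _ _ _ halg => FunctionFieldKaehler.functionFieldKaehler f halg

end Summit.ResolutionOfSingularities.ResolutionOfSingularities.Theorems.WeightedThesis.HypersurfaceModel

end
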